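import Mathlib

/-!
# PercRepro — THE LEVEL-`4` ARITHMETIC AT CORANKS `5 … 15` (night-1, gen 4)

`proofs/NIGHT-1-C025-induction.md` §15. On the `e`-free core of rank `p` and corank `d` (`n = p + d`) the level-`4`
inequality `Φ(p, 4)·#U ≤ #Y` follows (`level_four_arith`) from
`Φ ≤ 2^{p+4} / C(p+4, 4)`, `#U ≤ C(n, 4) + N`, `2^n ≤ #Y + A + B`, `8(A + B) ≤ 2^n` and the POLYNOMIAL inequality

  (P_d)  `8·(C(n, 4) + N) ≤ 7·2^{d−4}·C(p+4, 4)`,   `N = σ(d)·(C(d+2, 3)·C(n, 2) + C(d+3, 4)·n + C(d+4, 5))`,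

which holds for every `p ≥ 59` at each `5 ≤ d ≤ 15` (`level_four_poly`; the least thresholds are `28 / 45 / 57 / 59 /
54 / 46 / 39 / 33 / 27 / 23 / 20` at `d = 5 … 15`, `mining/night-1/g4/thresholds4.py`): with `p = 59 + t` both sides are
polynomials in `t` and the difference has non-negative coefficients (`mining/night-1/g4/coeffs4.py`), so `nlinarith`
closes each case from `t^i ≥ 0`. The tail `8(A + B) ≤ 2^n` comes from `16·Σ_{j ≤ 15} C(n, j) ≤ 2^n` for `n ≥ 41`
(`sixteen_mul_sum_choose_le`: Pascal gives `Σ_{j≤k} C(n+1, j) ≤ 2·Σ_{j≤k} C(n, j)`, and the base case is a numeral).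
Mathlib only. Axioms: standard.
-/

namespace PercRepro

/-- `24·C(m+4, 4) = (m+1)(m+2)(m+3)(m+4)`. -/
theorem choose_four_mul (m : ℕ) : 24 * (m + 4).choose 4 = (m + 1) * (m + 2) * (m + 3) * (m + 4) := by
  have h := Nat.descFactorial_eq_factorial_mul_choose (m + 4) 4
  simp only [Nat.descFactorial, Nat.factorial] at h
  have e1 : m + 4 - 3 = m + 1 := by omega
  have e2 : m + 4 - 2 = m + 2 := by omega
  have e3 : m + 4 - 1 = m + 3 := by omega
  have e4 : m + 4 - 0 = m + 4 := by omega
  rw [e1, e2, e3, e4] at h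
  linarith [h]

/-- `2·C(m+2, 2) = (m+1)(m+2)`. -/
theorem choose_two_mul (m : ℕ) : 2 * (m + 2).choose 2 = (m + 1) * (m + 2) := by
  have h := Nat.descFactorial_eq_factorial_mul_choose (m + 2) 2
  simp only [Nat.descFactorial, Nat.factorial] at h
  have e1 : m + 2 - 1 = m + 1 := by omega
  have e2 : m + 2 - 0 = m + 2 := by omega
  rw [e1, e2] at h
  linarith [h]

/-- Pascal on a partial row: `Σ_{j ≤ k} C(n+1, j) + C(n, k) = 2·Σ_{j ≤ k} C(n, j)`. -/
theorem sum_choose_succ_add_eq (n : ℕ) : ∀ k : ℕ,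
    ∑ j ∈ Finset.range (k + 1), (n + 1).choose j + n.choose k = 2 * ∑ j ∈ Finset.range (k + 1), n.choose j
  | 0 => by simp
  | k + 1 => by
    rw [Finset.sum_range_succ, Finset.sum_range_succ (fun j => n.choose j), Nat.choose_succ_succ']
    have ih := sum_choose_succ_add_eq n k
    omega

/-- `Σ_{j ≤ k} C(n+1, j) ≤ 2·Σ_{j ≤ k} C(n, j)`. -/
theorem sum_choose_succ_le_two_mul (n k : ℕ) :
    ∑ j ∈ Finset.range (k + 1), (n + 1).choose j ≤ 2 * ∑ j ∈ Finset.range (k + 1), n.choose j := by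
  have := sum_choose_succ_add_eq n k
  omega

/-- **The binomial tail**: `16·Σ_{j ≤ 15} C(n, j) ≤ 2^n` for every `n ≥ 41`. -/
theorem sixteen_mul_sum_choose_le (n : ℕ) (hn : 41 ≤ n) :
    16 * ∑ j ∈ Finset.range 16, n.choose j ≤ 2 ^ n := by
  induction n, hn using Nat.le_induction with
  | base =>
    simp only [Finset.sum_range_succ]
    norm_num [Nat.choose]
  | succ n hn ih =>
    have h : ∑ j ∈ Finset.range 16, (n + 1).choose j ≤ 2 * ∑ j ∈ Finset.range 16, n.choose j :=
      sum_choose_succ_le_two_mul n 15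
    rw [pow_succ]
    omega

/-- **The level-`4` arithmetic** (`n = p + d`, `d ≥ 4`): from `Φ ≤ 2^{p+4}/C(p+4, 4)`, `0 ≤ U ≤ C(n, 4) + N`,
`2^n ≤ Y + A + B`, `8(A + B) ≤ 2^n` and `8(C(n, 4) + N) ≤ 7·2^{d−4}·C(p+4, 4)`: `Φ·U ≤ Y`. -/
theorem level_four_arith {p d n : ℕ} {Φ U Y A B N : ℚ} (hn : n = p + d) (hd : 4 ≤ d)
    (hΦ : Φ ≤ (2 : ℚ) ^ (p + 4) / ((p + 4).choose 4 : ℚ)) (hU0 : 0 ≤ U)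
    (hU : U ≤ ((p + d).choose 4 : ℚ) + N) (hY : (2 : ℚ) ^ n ≤ Y + A + B) (hAB : 8 * (A + B) ≤ 2 ^ n)
    (hpoly : 8 * (((p + d).choose 4 : ℚ) + N) ≤ 7 * 2 ^ (d - 4) * ((p + 4).choose 4 : ℚ)) : Φ * U ≤ Y := by
  have hc : (0 : ℚ) < ((p + 4).choose 4 : ℚ) := by exact_mod_cast Nat.choose_pos (by omega)
  have hpow : (2 : ℚ) ^ n = 2 ^ (p + 4) * 2 ^ (d - 4) := by
    rw [← pow_add]; congr 1; omega
  have h1 : Φ * U ≤ (2 : ℚ) ^ (p + 4) / ((p + 4).choose 4 : ℚ) * U := mul_le_mul_of_nonneg_right hΦ hU0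
  have h2 : (2 : ℚ) ^ (p + 4) / ((p + 4).choose 4 : ℚ) * U ≤
      (2 : ℚ) ^ (p + 4) / ((p + 4).choose 4 : ℚ) * (((p + d).choose 4 : ℚ) + N) :=
    mul_le_mul_of_nonneg_left hU (by positivity)
  have h3 : (2 : ℚ) ^ (p + 4) / ((p + 4).choose 4 : ℚ) * (((p + d).choose 4 : ℚ) + N) ≤
      7 / 8 * 2 ^ n := by
    rw [hpow, div_mul_eq_mul_div, div_le_iff₀ hc]
    nlinarith [hpoly, pow_pos (show (0 : ℚ) < 2 by norm_num) (p + 4)]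
  linarith

/-- `(P_5)` for every `p ≥ 59` (`σ = 1`, `s₃ ≤ 35`, `s₄ ≤ 70`, `s₅ ≤ 126`). -/
theorem level_four_poly_5 (p : ℕ) (hp : 59 ≤ p) :
    8 * ((p + 5).choose 4 + (∑ j ∈ Finset.range (5 - 5 + 1), Nat.choose 5 j) *
      ((5 + 2).choose 3 * (p + 5).choose 2 + (5 + 3).choose 4 * (p + 5) + (5 + 4).choose 5)) ≤
      7 * 2 ^ (5 - 4) * (p + 4).choose 4 := by
  have hσ : (∑ j ∈ Finset.range (5 - 5 + 1), Nat.choose 5 j) = 1 := by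
    norm_num [Finset.sum_range_succ, Nat.choose]
  have hs3 : (5 + 2).choose 3 = 35 := by norm_num [Nat.choose]
  have hs4 : (5 + 3).choose 4 = 70 := by norm_num [Nat.choose]
  have hs5 : (5 + 4).choose 5 = 126 := by norm_num [Nat.choose]
  rw [hσ, hs3, hs4, hs5]
  obtain ⟨t, rfl⟩ : ∃ t, p = 59 + t := ⟨p - 59, by omega⟩
  have h1 : 24 * (59 + t + 5).choose 4 =
      (60 + t + 1) * (60 + t + 2) * (60 + t + 3) * (60 + t + 4) := by
    rw [show 59 + t + 5 = 60 + t + 4 by ring]; exact choose_four_mul (60 + t)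
  have h2 : 2 * (59 + t + 5).choose 2 = (62 + t + 1) * (62 + t + 2) := by
    rw [show 59 + t + 5 = 62 + t + 2 by ring]; exact choose_two_mul (62 + t)
  have h3 : 24 * (59 + t + 4).choose 4 = (59 + t + 1) * (59 + t + 2) * (59 + t + 3) * (59 + t + 4) :=
    choose_four_mul (59 + t)
  norm_num
  nlinarith [h1, h2, h3, Nat.zero_le t, Nat.zero_le (t * t), Nat.zero_le (t * t * t),
    Nat.zero_le (t * t * t * t)]

/-- `(P_6)` for every `p ≥ 59` (`σ = 6`, `s₃ ≤ 56`, `s₄ ≤ 126`, `s₅ ≤ 252`). -/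
theorem level_four_poly_6 (p : ℕ) (hp : 59 ≤ p) :
    8 * ((p + 6).choose 4 + (∑ j ∈ Finset.range (6 - 5 + 1), Nat.choose 5 j) *
      ((6 + 2).choose 3 * (p + 6).choose 2 + (6 + 3).choose 4 * (p + 6) + (6 + 4).choose 5)) ≤
      7 * 2 ^ (6 - 4) * (p + 4).choose 4 := by
  have hσ : (∑ j ∈ Finset.range (6 - 5 + 1), Nat.choose 5 j) = 6 := by
    norm_num [Finset.sum_range_succ, Nat.choose]
  have hs3 : (6 + 2).choose 3 = 56 := by norm_num [Nat.choose]
  have hs4 : (6 + 3).choose 4 = 126 := by norm_num [Nat.choose]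
  have hs5 : (6 + 4).choose 5 = 252 := by norm_num [Nat.choose]
  rw [hσ, hs3, hs4, hs5]
  obtain ⟨t, rfl⟩ : ∃ t, p = 59 + t := ⟨p - 59, by omega⟩
  have h1 : 24 * (59 + t + 6).choose 4 =
      (61 + t + 1) * (61 + t + 2) * (61 + t + 3) * (61 + t + 4) := by
    rw [show 59 + t + 6 = 61 + t + 4 by ring]; exact choose_four_mul (61 + t)
  have h2 : 2 * (59 + t + 6).choose 2 = (63 + t + 1) * (63 + t + 2) := by
    rw [show 59 + t + 6 = 63 + t + 2 by ring]; exact choose_two_mul (63 + t)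
  have h3 : 24 * (59 + t + 4).choose 4 = (59 + t + 1) * (59 + t + 2) * (59 + t + 3) * (59 + t + 4) :=
    choose_four_mul (59 + t)
  norm_num
  nlinarith [h1, h2, h3, Nat.zero_le t, Nat.zero_le (t * t), Nat.zero_le (t * t * t),
    Nat.zero_le (t * t * t * t)]

/-- `(P_7)` for every `p ≥ 59` (`σ = 16`, `s₃ ≤ 84`, `s₄ ≤ 210`, `s₅ ≤ 462`). -/
theorem level_four_poly_7 (p : ℕ) (hp : 59 ≤ p) :
    8 * ((p + 7).choose 4 + (∑ j ∈ Finset.range (7 - 5 + 1), Nat.choose 5 j) *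
      ((7 + 2).choose 3 * (p + 7).choose 2 + (7 + 3).choose 4 * (p + 7) + (7 + 4).choose 5)) ≤
      7 * 2 ^ (7 - 4) * (p + 4).choose 4 := by
  have hσ : (∑ j ∈ Finset.range (7 - 5 + 1), Nat.choose 5 j) = 16 := by
    norm_num [Finset.sum_range_succ, Nat.choose]
  have hs3 : (7 + 2).choose 3 = 84 := by norm_num [Nat.choose]
  have hs4 : (7 + 3).choose 4 = 210 := by norm_num [Nat.choose]
  have hs5 : (7 + 4).choose 5 = 462 := by norm_num [Nat.choose]
  rw [hσ, hs3, hs4, hs5]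
  obtain ⟨t, rfl⟩ : ∃ t, p = 59 + t := ⟨p - 59, by omega⟩
  have h1 : 24 * (59 + t + 7).choose 4 =
      (62 + t + 1) * (62 + t + 2) * (62 + t + 3) * (62 + t + 4) := by
    rw [show 59 + t + 7 = 62 + t + 4 by ring]; exact choose_four_mul (62 + t)
  have h2 : 2 * (59 + t + 7).choose 2 = (64 + t + 1) * (64 + t + 2) := by
    rw [show 59 + t + 7 = 64 + t + 2 by ring]; exact choose_two_mul (64 + t)
  have h3 : 24 * (59 + t + 4).choose 4 = (59 + t + 1) * (59 + t + 2) * (59 + t + 3) * (59 + t + 4) :=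
    choose_four_mul (59 + t)
  norm_num
  nlinarith [h1, h2, h3, Nat.zero_le t, Nat.zero_le (t * t), Nat.zero_le (t * t * t),
    Nat.zero_le (t * t * t * t)]

/-- `(P_8)` for every `p ≥ 59` (`σ = 26`, `s₃ ≤ 120`, `s₄ ≤ 330`, `s₅ ≤ 792`). -/
theorem level_four_poly_8 (p : ℕ) (hp : 59 ≤ p) :
    8 * ((p + 8).choose 4 + (∑ j ∈ Finset.range (8 - 5 + 1), Nat.choose 5 j) *
      ((8 + 2).choose 3 * (p + 8).choose 2 + (8 + 3).choose 4 * (p + 8) + (8 + 4).choose 5)) ≤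
      7 * 2 ^ (8 - 4) * (p + 4).choose 4 := by
  have hσ : (∑ j ∈ Finset.range (8 - 5 + 1), Nat.choose 5 j) = 26 := by
    norm_num [Finset.sum_range_succ, Nat.choose]
  have hs3 : (8 + 2).choose 3 = 120 := by norm_num [Nat.choose]
  have hs4 : (8 + 3).choose 4 = 330 := by norm_num [Nat.choose]
  have hs5 : (8 + 4).choose 5 = 792 := by norm_num [Nat.choose]
  rw [hσ, hs3, hs4, hs5]
  obtain ⟨t, rfl⟩ : ∃ t, p = 59 + t := ⟨p - 59, by omega⟩
  have h1 : 24 * (59 + t + 8).choose 4 =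
      (63 + t + 1) * (63 + t + 2) * (63 + t + 3) * (63 + t + 4) := by
    rw [show 59 + t + 8 = 63 + t + 4 by ring]; exact choose_four_mul (63 + t)
  have h2 : 2 * (59 + t + 8).choose 2 = (65 + t + 1) * (65 + t + 2) := by
    rw [show 59 + t + 8 = 65 + t + 2 by ring]; exact choose_two_mul (65 + t)
  have h3 : 24 * (59 + t + 4).choose 4 = (59 + t + 1) * (59 + t + 2) * (59 + t + 3) * (59 + t + 4) :=
    choose_four_mul (59 + t)
  norm_num
  nlinarith [h1, h2, h3, Nat.zero_le t, Nat.zero_le (t * t), Nat.zero_le (t * t * t),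
    Nat.zero_le (t * t * t * t)]

/-- `(P_9)` for every `p ≥ 59` (`σ = 31`, `s₃ ≤ 165`, `s₄ ≤ 495`, `s₅ ≤ 1287`). -/
theorem level_four_poly_9 (p : ℕ) (hp : 59 ≤ p) :
    8 * ((p + 9).choose 4 + (∑ j ∈ Finset.range (9 - 5 + 1), Nat.choose 5 j) *
      ((9 + 2).choose 3 * (p + 9).choose 2 + (9 + 3).choose 4 * (p + 9) + (9 + 4).choose 5)) ≤
      7 * 2 ^ (9 - 4) * (p + 4).choose 4 := by
  have hσ : (∑ j ∈ Finset.range (9 - 5 + 1), Nat.choose 5 j) = 31 := by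
    norm_num [Finset.sum_range_succ, Nat.choose]
  have hs3 : (9 + 2).choose 3 = 165 := by norm_num [Nat.choose]
  have hs4 : (9 + 3).choose 4 = 495 := by norm_num [Nat.choose]
  have hs5 : (9 + 4).choose 5 = 1287 := by norm_num [Nat.choose]
  rw [hσ, hs3, hs4, hs5]
  obtain ⟨t, rfl⟩ : ∃ t, p = 59 + t := ⟨p - 59, by omega⟩
  have h1 : 24 * (59 + t + 9).choose 4 =
      (64 + t + 1) * (64 + t + 2) * (64 + t + 3) * (64 + t + 4) := by
    rw [show 59 + t + 9 = 64 + t + 4 by ring]; exact choose_four_mul (64 + t)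
  have h2 : 2 * (59 + t + 9).choose 2 = (66 + t + 1) * (66 + t + 2) := by
    rw [show 59 + t + 9 = 66 + t + 2 by ring]; exact choose_two_mul (66 + t)
  have h3 : 24 * (59 + t + 4).choose 4 = (59 + t + 1) * (59 + t + 2) * (59 + t + 3) * (59 + t + 4) :=
    choose_four_mul (59 + t)
  norm_num
  nlinarith [h1, h2, h3, Nat.zero_le t, Nat.zero_le (t * t), Nat.zero_le (t * t * t),
    Nat.zero_le (t * t * t * t)]

/-- `(P_10)` for every `p ≥ 59` (`σ = 32`, `s₃ ≤ 220`, `s₄ ≤ 715`, `s₅ ≤ 2002`). -/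
theorem level_four_poly_10 (p : ℕ) (hp : 59 ≤ p) :
    8 * ((p + 10).choose 4 + (∑ j ∈ Finset.range (10 - 5 + 1), Nat.choose 5 j) *
      ((10 + 2).choose 3 * (p + 10).choose 2 + (10 + 3).choose 4 * (p + 10) + (10 + 4).choose 5)) ≤
      7 * 2 ^ (10 - 4) * (p + 4).choose 4 := by
  have hσ : (∑ j ∈ Finset.range (10 - 5 + 1), Nat.choose 5 j) = 32 := by
    norm_num [Finset.sum_range_succ, Nat.choose]
  have hs3 : (10 + 2).choose 3 = 220 := by norm_num [Nat.choose]
  have hs4 : (10 + 3).choose 4 = 715 := by norm_num [Nat.choose]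
  have hs5 : (10 + 4).choose 5 = 2002 := by norm_num [Nat.choose]
  rw [hσ, hs3, hs4, hs5]
  obtain ⟨t, rfl⟩ : ∃ t, p = 59 + t := ⟨p - 59, by omega⟩
  have h1 : 24 * (59 + t + 10).choose 4 =
      (65 + t + 1) * (65 + t + 2) * (65 + t + 3) * (65 + t + 4) := by
    rw [show 59 + t + 10 = 65 + t + 4 by ring]; exact choose_four_mul (65 + t)
  have h2 : 2 * (59 + t + 10).choose 2 = (67 + t + 1) * (67 + t + 2) := by
    rw [show 59 + t + 10 = 67 + t + 2 by ring]; exact choose_two_mul (67 + t)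
  have h3 : 24 * (59 + t + 4).choose 4 = (59 + t + 1) * (59 + t + 2) * (59 + t + 3) * (59 + t + 4) :=
    choose_four_mul (59 + t)
  norm_num
  nlinarith [h1, h2, h3, Nat.zero_le t, Nat.zero_le (t * t), Nat.zero_le (t * t * t),
    Nat.zero_le (t * t * t * t)]

/-- `(P_11)` for every `p ≥ 59` (`σ = 32`, `s₃ ≤ 286`, `s₄ ≤ 1001`, `s₅ ≤ 3003`). -/
theorem level_four_poly_11 (p : ℕ) (hp : 59 ≤ p) :
    8 * ((p + 11).choose 4 + (∑ j ∈ Finset.range (11 - 5 + 1), Nat.choose 5 j) *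
      ((11 + 2).choose 3 * (p + 11).choose 2 + (11 + 3).choose 4 * (p + 11) + (11 + 4).choose 5)) ≤
      7 * 2 ^ (11 - 4) * (p + 4).choose 4 := by
  have hσ : (∑ j ∈ Finset.range (11 - 5 + 1), Nat.choose 5 j) = 32 := by
    norm_num [Finset.sum_range_succ, Nat.choose]
  have hs3 : (11 + 2).choose 3 = 286 := by norm_num [Nat.choose]
  have hs4 : (11 + 3).choose 4 = 1001 := by norm_num [Nat.choose]
  have hs5 : (11 + 4).choose 5 = 3003 := by norm_num [Nat.choose]
  rw [hσ, hs3, hs4, hs5]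
  obtain ⟨t, rfl⟩ : ∃ t, p = 59 + t := ⟨p - 59, by omega⟩
  have h1 : 24 * (59 + t + 11).choose 4 =
      (66 + t + 1) * (66 + t + 2) * (66 + t + 3) * (66 + t + 4) := by
    rw [show 59 + t + 11 = 66 + t + 4 by ring]; exact choose_four_mul (66 + t)
  have h2 : 2 * (59 + t + 11).choose 2 = (68 + t + 1) * (68 + t + 2) := by
    rw [show 59 + t + 11 = 68 + t + 2 by ring]; exact choose_two_mul (68 + t)
  have h3 : 24 * (59 + t + 4).choose 4 = (59 + t + 1) * (59 + t + 2) * (59 + t + 3) * (59 + t + 4) :=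
    choose_four_mul (59 + t)
  norm_num
  nlinarith [h1, h2, h3, Nat.zero_le t, Nat.zero_le (t * t), Nat.zero_le (t * t * t),
    Nat.zero_le (t * t * t * t)]

/-- `(P_12)` for every `p ≥ 59` (`σ = 32`, `s₃ ≤ 364`, `s₄ ≤ 1365`, `s₅ ≤ 4368`). -/
theorem level_four_poly_12 (p : ℕ) (hp : 59 ≤ p) :
    8 * ((p + 12).choose 4 + (∑ j ∈ Finset.range (12 - 5 + 1), Nat.choose 5 j) *
      ((12 + 2).choose 3 * (p + 12).choose 2 + (12 + 3).choose 4 * (p + 12) + (12 + 4).choose 5)) ≤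
      7 * 2 ^ (12 - 4) * (p + 4).choose 4 := by
  have hσ : (∑ j ∈ Finset.range (12 - 5 + 1), Nat.choose 5 j) = 32 := by
    norm_num [Finset.sum_range_succ, Nat.choose]
  have hs3 : (12 + 2).choose 3 = 364 := by norm_num [Nat.choose]
  have hs4 : (12 + 3).choose 4 = 1365 := by norm_num [Nat.choose]
  have hs5 : (12 + 4).choose 5 = 4368 := by norm_num [Nat.choose]
  rw [hσ, hs3, hs4, hs5]
  obtain ⟨t, rfl⟩ : ∃ t, p = 59 + t := ⟨p - 59, by omega⟩
  have h1 : 24 * (59 + t + 12).choose 4 =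
      (67 + t + 1) * (67 + t + 2) * (67 + t + 3) * (67 + t + 4) := by
    rw [show 59 + t + 12 = 67 + t + 4 by ring]; exact choose_four_mul (67 + t)
  have h2 : 2 * (59 + t + 12).choose 2 = (69 + t + 1) * (69 + t + 2) := by
    rw [show 59 + t + 12 = 69 + t + 2 by ring]; exact choose_two_mul (69 + t)
  have h3 : 24 * (59 + t + 4).choose 4 = (59 + t + 1) * (59 + t + 2) * (59 + t + 3) * (59 + t + 4) :=
    choose_four_mul (59 + t)
  norm_num
  nlinarith [h1, h2, h3, Nat.zero_le t, Nat.zero_le (t * t), Nat.zero_le (t * t * t),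
    Nat.zero_le (t * t * t * t)]

/-- `(P_13)` for every `p ≥ 59` (`σ = 32`, `s₃ ≤ 455`, `s₄ ≤ 1820`, `s₅ ≤ 6188`). -/
theorem level_four_poly_13 (p : ℕ) (hp : 59 ≤ p) :
    8 * ((p + 13).choose 4 + (∑ j ∈ Finset.range (13 - 5 + 1), Nat.choose 5 j) *
      ((13 + 2).choose 3 * (p + 13).choose 2 + (13 + 3).choose 4 * (p + 13) + (13 + 4).choose 5)) ≤
      7 * 2 ^ (13 - 4) * (p + 4).choose 4 := by
  have hσ : (∑ j ∈ Finset.range (13 - 5 + 1), Nat.choose 5 j) = 32 := by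
    norm_num [Finset.sum_range_succ, Nat.choose]
  have hs3 : (13 + 2).choose 3 = 455 := by norm_num [Nat.choose]
  have hs4 : (13 + 3).choose 4 = 1820 := by norm_num [Nat.choose]
  have hs5 : (13 + 4).choose 5 = 6188 := by norm_num [Nat.choose]
  rw [hσ, hs3, hs4, hs5]
  obtain ⟨t, rfl⟩ : ∃ t, p = 59 + t := ⟨p - 59, by omega⟩
  have h1 : 24 * (59 + t + 13).choose 4 =
      (68 + t + 1) * (68 + t + 2) * (68 + t + 3) * (68 + t + 4) := by
    rw [show 59 + t + 13 = 68 + t + 4 by ring]; exact choose_four_mul (68 + t)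
  have h2 : 2 * (59 + t + 13).choose 2 = (70 + t + 1) * (70 + t + 2) := by
    rw [show 59 + t + 13 = 70 + t + 2 by ring]; exact choose_two_mul (70 + t)
  have h3 : 24 * (59 + t + 4).choose 4 = (59 + t + 1) * (59 + t + 2) * (59 + t + 3) * (59 + t + 4) :=
    choose_four_mul (59 + t)
  norm_num
  nlinarith [h1, h2, h3, Nat.zero_le t, Nat.zero_le (t * t), Nat.zero_le (t * t * t),
    Nat.zero_le (t * t * t * t)]

/-- `(P_14)` for every `p ≥ 59` (`σ = 32`, `s₃ ≤ 560`, `s₄ ≤ 2380`, `s₅ ≤ 8568`). -/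
theorem level_four_poly_14 (p : ℕ) (hp : 59 ≤ p) :
    8 * ((p + 14).choose 4 + (∑ j ∈ Finset.range (14 - 5 + 1), Nat.choose 5 j) *
      ((14 + 2).choose 3 * (p + 14).choose 2 + (14 + 3).choose 4 * (p + 14) + (14 + 4).choose 5)) ≤
      7 * 2 ^ (14 - 4) * (p + 4).choose 4 := by
  have hσ : (∑ j ∈ Finset.range (14 - 5 + 1), Nat.choose 5 j) = 32 := by
    norm_num [Finset.sum_range_succ, Nat.choose]
  have hs3 : (14 + 2).choose 3 = 560 := by norm_num [Nat.choose]
  have hs4 : (14 + 3).choose 4 = 2380 := by norm_num [Nat.choose]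
  have hs5 : (14 + 4).choose 5 = 8568 := by norm_num [Nat.choose]
  rw [hσ, hs3, hs4, hs5]
  obtain ⟨t, rfl⟩ : ∃ t, p = 59 + t := ⟨p - 59, by omega⟩
  have h1 : 24 * (59 + t + 14).choose 4 =
      (69 + t + 1) * (69 + t + 2) * (69 + t + 3) * (69 + t + 4) := by
    rw [show 59 + t + 14 = 69 + t + 4 by ring]; exact choose_four_mul (69 + t)
  have h2 : 2 * (59 + t + 14).choose 2 = (71 + t + 1) * (71 + t + 2) := by
    rw [show 59 + t + 14 = 71 + t + 2 by ring]; exact choose_two_mul (71 + t)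
  have h3 : 24 * (59 + t + 4).choose 4 = (59 + t + 1) * (59 + t + 2) * (59 + t + 3) * (59 + t + 4) :=
    choose_four_mul (59 + t)
  norm_num
  nlinarith [h1, h2, h3, Nat.zero_le t, Nat.zero_le (t * t), Nat.zero_le (t * t * t),
    Nat.zero_le (t * t * t * t)]

/-- `(P_15)` for every `p ≥ 59` (`σ = 32`, `s₃ ≤ 680`, `s₄ ≤ 3060`, `s₅ ≤ 11628`). -/
theorem level_four_poly_15 (p : ℕ) (hp : 59 ≤ p) :
    8 * ((p + 15).choose 4 + (∑ j ∈ Finset.range (15 - 5 + 1), Nat.choose 5 j) *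
      ((15 + 2).choose 3 * (p + 15).choose 2 + (15 + 3).choose 4 * (p + 15) + (15 + 4).choose 5)) ≤
      7 * 2 ^ (15 - 4) * (p + 4).choose 4 := by
  have hσ : (∑ j ∈ Finset.range (15 - 5 + 1), Nat.choose 5 j) = 32 := by
    norm_num [Finset.sum_range_succ, Nat.choose]
  have hs3 : (15 + 2).choose 3 = 680 := by norm_num [Nat.choose]
  have hs4 : (15 + 3).choose 4 = 3060 := by norm_num [Nat.choose]
  have hs5 : (15 + 4).choose 5 = 11628 := by norm_num [Nat.choose]
  rw [hσ, hs3, hs4, hs5]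
  obtain ⟨t, rfl⟩ : ∃ t, p = 59 + t := ⟨p - 59, by omega⟩
  have h1 : 24 * (59 + t + 15).choose 4 =
      (70 + t + 1) * (70 + t + 2) * (70 + t + 3) * (70 + t + 4) := by
    rw [show 59 + t + 15 = 70 + t + 4 by ring]; exact choose_four_mul (70 + t)
  have h2 : 2 * (59 + t + 15).choose 2 = (72 + t + 1) * (72 + t + 2) := by
    rw [show 59 + t + 15 = 72 + t + 2 by ring]; exact choose_two_mul (72 + t)
  have h3 : 24 * (59 + t + 4).choose 4 = (59 + t + 1) * (59 + t + 2) * (59 + t + 3) * (59 + t + 4) :=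
    choose_four_mul (59 + t)
  norm_num
  nlinarith [h1, h2, h3, Nat.zero_le t, Nat.zero_le (t * t), Nat.zero_le (t * t * t),
    Nat.zero_le (t * t * t * t)]

/-- **`(P_d)` at every corank `5 ≤ d ≤ 15` for every `p ≥ 59`**:
`8·(C(p+d, 4) + σ(d)·(C(d+2, 3)·C(p+d, 2) + C(d+3, 4)·(p+d) + C(d+4, 5))) ≤ 7·2^{d−4}·C(p+4, 4)`. -/
theorem level_four_poly (d : ℕ) (hd5 : 5 ≤ d) (hd15 : d ≤ 15) (p : ℕ) (hp : 59 ≤ p) :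
    8 * ((p + d).choose 4 + (∑ j ∈ Finset.range (d - 5 + 1), Nat.choose 5 j) *
      ((d + 2).choose 3 * (p + d).choose 2 + (d + 3).choose 4 * (p + d) + (d + 4).choose 5)) ≤
      7 * 2 ^ (d - 4) * (p + 4).choose 4 := by
  interval_cases d
  · exact level_four_poly_5 p hp
  · exact level_four_poly_6 p hp
  · exact level_four_poly_7 p hp
  · exact level_four_poly_8 p hp
  · exact level_four_poly_9 p hp
  · exact level_four_poly_10 p hp
  · exact level_four_poly_11 p hp
  · exact level_four_poly_12 p hp
  · exact level_four_poly_13 p hp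
  · exact level_four_poly_14 p hp
  · exact level_four_poly_15 p hp

end PercRepro
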